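import Summits.Ventures.QEC.CircuitDistance.PortTranslate
import Summits.Ventures.QEC.CircuitDistance.SchedStructure
import HarnessLib

/-!
# Q4 lane, ₛ-spine (7): the sector column of a fault is the column of its kind representative, and translation
# EQUIVARIANCE — for an ARBITRARY event list (venture QEC, experiment cell CDX, seat qec-cdx-type-2; the `PortKindColumns.lean` layer
# and the `run1`-level corollaries of `PortTranslate.lean` re-stated at `Gen` level; proofs verbatim with `run1 S Nc ↦ Gen.run1 S es`,
# `allEvents Nc ↦ es`; nothing here asserts a value of `d_circ`)

Both facts are ORDER-FREE: they hold for every event list `es`, in particular for `allEventsₛ σ Nc` of any CNOT order — the kinds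
(`PortKinds.lean`: `XKind`/`ZKind`, `Fault.xKind`, `xHalf_simulate`, …) and the translation machinery (`PortTranslate.lean`:
`Fault.translate`, `simulate_translate`, `HZ_mulVec_translate`, …) of the files of record are already generic in the event list and
are reused by name.
* `Gen.xColumn_eq_of_xHalf`, **`Gen.xColumn_eq_of_xKind`**, **`Gen.xColumn_zero_of_xKind`** (+ `Z` mirrors): a 42-row table per
  (code, order) describes every column;
* `Gen.run1_translate`, `shapeₛ_translate`, `Gen.dataX/dataZ_translate_singleton`, `Gen.detZ/detX_translate_singleton`:
  `ℤ_ℓ × ℤ_m` equivariance of single-fault columns, any event list / any schedule.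
-/

namespace Summit.Ventures.QEC.CircuitDistance

open Literature.InformationTheory.QuantumCodes

variable {ℓ m : ℕ} [NeZero ℓ] [NeZero m]

/-! ## Columns are determined by the sector kind (any event list) -/

/-- The `X`-sector column of a fault is determined by the `X`-half of its run. -/
theorem Gen.xColumn_eq_of_xHalf (S : SMCode ℓ m) (Nc : ℕ) (es : List Ev) {f g : Fault ℓ m}
    (h : (Gen.run1 S es f).xHalf = (Gen.run1 S es g).xHalf) :
    (∀ t j, Gen.detZ S Nc es {f} t j = Gen.detZ S Nc es {g} t j) ∧ Gen.dataX S es {f} = Gen.dataX S es {g} := by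
  have hf : ∀ q, ((Gen.run1 S es f).frame q).1 = ((Gen.run1 S es g).frame q).1 := fun q => congrFun (congrArg Prod.fst h) q
  have hm : (Gen.run1 S es f).mZ = (Gen.run1 S es g).mZ := congrArg Prod.snd h
  have hd : Gen.dataX S es {f} = Gen.dataX S es {g} := by
    rw [Gen.dataX_singleton_run1, Gen.dataX_singleton_run1]; congr 1; funext q; exact hf _
  refine ⟨fun t j => ?_, hd⟩
  unfold Gen.detZ; simp only [Gen.flipZ_singleton, hm, hd]

/-- Mirror. -/
theorem Gen.zColumn_eq_of_zHalf (S : SMCode ℓ m) (Nc : ℕ) (es : List Ev) {f g : Fault ℓ m}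
    (h : (Gen.run1 S es f).zHalf = (Gen.run1 S es g).zHalf) :
    (∀ t i, Gen.detX S Nc es {f} t i = Gen.detX S Nc es {g} t i) ∧ Gen.dataZ S es {f} = Gen.dataZ S es {g} := by
  have hf : ∀ q, ((Gen.run1 S es f).frame q).2 = ((Gen.run1 S es g).frame q).2 := fun q => congrFun (congrArg Prod.fst h) q
  have hm : (Gen.run1 S es f).mX = (Gen.run1 S es g).mX := congrArg Prod.snd h
  have hd : Gen.dataZ S es {f} = Gen.dataZ S es {g} := by
    rw [Gen.dataZ_singleton_run1, Gen.dataZ_singleton_run1]; congr 1; funext q; exact hf _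
  refine ⟨fun t i => ?_, hd⟩
  unfold Gen.detX; simp only [Gen.flipX_singleton, hm, hd]

/-- **x/z-INDEPENDENCE.** The `X`-sector column of a fault is that of its `X`-kind representative … -/
theorem Gen.xColumn_eq_of_xKind (S : SMCode ℓ m) (Nc : ℕ) (es : List Ev) (f : Fault ℓ m) {k : XKind} {i : BB.Mono ℓ m}
    (h : f.xKind = some (k, i)) :
    (∀ t j, Gen.detZ S Nc es {f} t j = Gen.detZ S Nc es {k.fault f.cyc i} t j) ∧
      Gen.dataX S es {f} = Gen.dataX S es {k.fault f.cyc i} := by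
  apply Gen.xColumn_eq_of_xHalf
  unfold Gen.run1
  apply xHalf_simulate S (Fault.ev_xKind h)
  · intro st st' hst
    have hfr : ∀ q, (st.frame q).1 = (st'.frame q).1 := fun q => congrFun (congrArg Prod.fst hst) q
    have hm : st.mZ = st'.mZ := congrArg Prod.snd hst
    cases f with
    | cnot c lay i' pc pt =>
      simp only [Fault.xKind] at h
      split_ifs at h with hb
      obtain ⟨rfl, rfl⟩ := Prod.mk.inj (Option.some_injective _ h)
      simp only [inject, XKind.fault, State.xHalf, Fault.cyc, Prod.mk.injEq]
      refine ⟨?_, hm⟩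
      funext q; simp only [Frame.mulAt, P1.mul_def]; split_ifs <;> simp [hfr]
    | idle c s i' p =>
      simp only [Fault.xKind] at h
      split_ifs at h with hb
      obtain ⟨rfl, rfl⟩ := Prod.mk.inj (Option.some_injective _ h)
      simp only [inject, XKind.fault, State.xHalf, Fault.cyc, Prod.mk.injEq]
      refine ⟨?_, hm⟩
      funext q; simp only [Frame.mulAt, P1.mul_def]; split_ifs <;> simp [hfr, hb]
    | initX c i' => simp [Fault.xKind] at h
    | measX c i' => simp [Fault.xKind] at h
    | initZ c i' =>
      simp only [Fault.xKind, Option.some.injEq, Prod.mk.injEq] at h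
      obtain ⟨rfl, rfl⟩ := h
      simp only [inject, XKind.fault, State.xHalf, Fault.cyc, Prod.mk.injEq]
      refine ⟨?_, hm⟩
      funext q; simp only [Frame.mulAt, P1.mul_def]; split_ifs <;> simp [hfr]
    | measZ c i' =>
      simp only [Fault.xKind, Option.some.injEq, Prod.mk.injEq] at h
      obtain ⟨rfl, rfl⟩ := h
      simp only [inject, XKind.fault, State.xHalf, Fault.cyc, Prod.mk.injEq]
      refine ⟨funext fun q => hfr q, ?_⟩
      funext c' j; rw [hm]
  · rfl

/-- … and zero if the fault has no `X`-part. -/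
theorem Gen.xColumn_zero_of_xKind (S : SMCode ℓ m) (Nc : ℕ) (es : List Ev) (f : Fault ℓ m) (h : f.xKind = none) :
    (∀ t j, Gen.detZ S Nc es {f} t j = false) ∧ Gen.dataX S es {f} = 0 := by
  have hx : (Gen.run1 S es f).xHalf = (State.init : State ℓ m).xHalf := by
    unfold Gen.run1
    conv_rhs => rw [← evolve_init S es]
    apply xHalf_simulate_none S _ es rfl
    intro st
    cases f with
    | cnot c lay i' pc pt =>
      simp only [Fault.xKind] at h
      split_ifs at h with hb
      simp only [Bool.or_eq_true, not_or, Bool.not_eq_true] at hb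
      simp only [inject, State.xHalf, Prod.mk.injEq, and_true]
      funext q; simp only [Frame.mulAt, P1.mul_def]; split_ifs <;> simp [hb]
    | idle c s i' p =>
      simp only [Fault.xKind] at h
      split_ifs at h with hb
      simp only [Bool.not_eq_true] at hb
      simp only [inject, State.xHalf, Prod.mk.injEq, and_true]
      funext q; simp only [Frame.mulAt, P1.mul_def]; split_ifs <;> simp [hb]
    | initX c i' =>
      simp only [inject, State.xHalf, Prod.mk.injEq, and_true]
      funext q; simp only [Frame.mulAt, P1.mul_def]; split_ifs <;> simp
    | measX c i' => rfl
    | initZ c i' => simp [Fault.xKind] at h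
    | measZ c i' => simp [Fault.xKind] at h
  have hfq : ∀ q, ((Gen.run1 S es f).frame q).1 = false := fun q => congrFun (congrArg Prod.fst hx) q
  have hd : Gen.dataX S es {f} = 0 := by
    rw [Gen.dataX_singleton_run1]; funext q; unfold toZ2 Frame.dataXb
    rw [hfq]; rfl
  refine ⟨fun t j => ?_, hd⟩
  have hm : (Gen.run1 S es f).mZ = fun _ _ => false := congrArg Prod.snd hx
  unfold Gen.detZ; simp only [Gen.flipZ_singleton, hm, hd, Matrix.mulVec_zero]
  simp

/-- `Z` mirror of `xColumn_eq_of_xKind`. -/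
theorem Gen.zColumn_eq_of_zKind (S : SMCode ℓ m) (Nc : ℕ) (es : List Ev) (f : Fault ℓ m) {k : ZKind} {i : BB.Mono ℓ m}
    (h : f.zKind = some (k, i)) :
    (∀ t i', Gen.detX S Nc es {f} t i' = Gen.detX S Nc es {k.fault f.cyc i} t i') ∧
      Gen.dataZ S es {f} = Gen.dataZ S es {k.fault f.cyc i} := by
  apply Gen.zColumn_eq_of_zHalf
  unfold Gen.run1
  apply zHalf_simulate S (Fault.ev_zKind h)
  · intro st st' hst
    have hfr : ∀ q, (st.frame q).2 = (st'.frame q).2 := fun q => congrFun (congrArg Prod.fst hst) q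
    have hm : st.mX = st'.mX := congrArg Prod.snd hst
    cases f with
    | cnot c lay i' pc pt =>
      simp only [Fault.zKind] at h
      split_ifs at h with hb
      obtain ⟨rfl, rfl⟩ := Prod.mk.inj (Option.some_injective _ h)
      simp only [inject, ZKind.fault, State.zHalf, Fault.cyc, Prod.mk.injEq]
      refine ⟨?_, hm⟩
      funext q; simp only [Frame.mulAt, P1.mul_def]; split_ifs <;> simp [hfr]
    | idle c s i' p =>
      simp only [Fault.zKind] at h
      split_ifs at h with hb
      obtain ⟨rfl, rfl⟩ := Prod.mk.inj (Option.some_injective _ h)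
      simp only [inject, ZKind.fault, State.zHalf, Fault.cyc, Prod.mk.injEq]
      refine ⟨?_, hm⟩
      funext q; simp only [Frame.mulAt, P1.mul_def]; split_ifs <;> simp [hfr, hb]
    | initZ c i' => simp [Fault.zKind] at h
    | measZ c i' => simp [Fault.zKind] at h
    | initX c i' =>
      simp only [Fault.zKind, Option.some.injEq, Prod.mk.injEq] at h
      obtain ⟨rfl, rfl⟩ := h
      simp only [inject, ZKind.fault, State.zHalf, Fault.cyc, Prod.mk.injEq]
      refine ⟨?_, hm⟩
      funext q; simp only [Frame.mulAt, P1.mul_def]; split_ifs <;> simp [hfr]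
    | measX c i' =>
      simp only [Fault.zKind, Option.some.injEq, Prod.mk.injEq] at h
      obtain ⟨rfl, rfl⟩ := h
      simp only [inject, ZKind.fault, State.zHalf, Fault.cyc, Prod.mk.injEq]
      refine ⟨funext fun q => hfr q, ?_⟩
      funext c' j; rw [hm]
  · rfl

/-- `Z` mirror of `xColumn_zero_of_xKind`. -/
theorem Gen.zColumn_zero_of_zKind (S : SMCode ℓ m) (Nc : ℕ) (es : List Ev) (f : Fault ℓ m) (h : f.zKind = none) :
    (∀ t i, Gen.detX S Nc es {f} t i = false) ∧ Gen.dataZ S es {f} = 0 := by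
  have hx : (Gen.run1 S es f).zHalf = (State.init : State ℓ m).zHalf := by
    unfold Gen.run1
    conv_rhs => rw [← evolve_init S es]
    apply zHalf_simulate_none S _ es rfl
    intro st
    cases f with
    | cnot c lay i' pc pt =>
      simp only [Fault.zKind] at h
      split_ifs at h with hb
      simp only [Bool.or_eq_true, not_or, Bool.not_eq_true] at hb
      simp only [inject, State.zHalf, Prod.mk.injEq, and_true]
      funext q; simp only [Frame.mulAt, P1.mul_def]; split_ifs <;> simp [hb]
    | idle c s i' p =>
      simp only [Fault.zKind] at h
      split_ifs at h with hb
      simp only [Bool.not_eq_true] at hb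
      simp only [inject, State.zHalf, Prod.mk.injEq, and_true]
      funext q; simp only [Frame.mulAt, P1.mul_def]; split_ifs <;> simp [hb]
    | initZ c i' =>
      simp only [inject, State.zHalf, Prod.mk.injEq, and_true]
      funext q; simp only [Frame.mulAt, P1.mul_def]; split_ifs <;> simp
    | measZ c i' => rfl
    | initX c i' => simp [Fault.zKind] at h
    | measX c i' => simp [Fault.zKind] at h
  have hfq : ∀ q, ((Gen.run1 S es f).frame q).2 = false := fun q => congrFun (congrArg Prod.fst hx) q
  have hd : Gen.dataZ S es {f} = 0 := by
    rw [Gen.dataZ_singleton_run1]; funext q; unfold toZ2 Frame.dataZb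
    rw [hfq]; rfl
  refine ⟨fun t i => ?_, hd⟩
  have hm : (Gen.run1 S es f).mX = fun _ _ => false := congrArg Prod.snd hx
  unfold Gen.detX; simp only [Gen.flipX_singleton, hm, hd, Matrix.mulVec_zero]
  simp

/-! ## Translation equivariance (any event list / any schedule) -/

/-- **EQUIVARIANCE of `Gen.run1`.** The effect of a translated fault is the translated effect, for any event list. -/
theorem Gen.run1_translate (S : SMCode ℓ m) (es : List Ev) (f : Fault ℓ m) (t : BB.Mono ℓ m) :
    Gen.run1 S es (f.translate t) = (Gen.run1 S es f).translate t := by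
  unfold Gen.run1; rw [← simulate_translate, State.init_translate]

/-- Shapes under any schedule are translation-equivariant (cf. `shape_translate`). -/
theorem shapeₛ_translate (σ : SMSchedule) (S : SMCode ℓ m) (f : Fault ℓ m) (t : BB.Mono ℓ m) :
    shapeₛ σ S (f.translate t) = (shapeₛ σ S f).translate t := by
  unfold shapeₛ; rw [Fault.cyc_translate, ← simulate_translate, State.init_translate]

/-- Residual `X`-error of a translated fault (any event list). -/
theorem Gen.dataX_translate_singleton (S : SMCode ℓ m) (es : List Ev) (f : Fault ℓ m) (t : BB.Mono ℓ m) :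
    Gen.dataX S es {f.translate t} = fun q => Gen.dataX S es {f} ((BB.Code.translate t).symm q) := by
  rw [Gen.dataX_singleton_run1, Gen.dataX_singleton_run1, Gen.run1_translate]
  funext q
  simp only [toZ2, dataXb_translate]

/-- Residual `Z`-error of a translated fault (any event list). -/
theorem Gen.dataZ_translate_singleton (S : SMCode ℓ m) (es : List Ev) (f : Fault ℓ m) (t : BB.Mono ℓ m) :
    Gen.dataZ S es {f.translate t} = fun q => Gen.dataZ S es {f} ((BB.Code.translate t).symm q) := by
  rw [Gen.dataZ_singleton_run1, Gen.dataZ_singleton_run1, Gen.run1_translate]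
  funext q
  simp only [toZ2, dataZb_translate]

/-- `Z`-detectors of a translated fault (any event list). -/
theorem Gen.detZ_translate_singleton (S : SMCode ℓ m) (Nc : ℕ) (es : List Ev) (f : Fault ℓ m) (t : BB.Mono ℓ m) (s : ℕ)
    (j : BB.Mono ℓ m) : Gen.detZ S Nc es {f.translate t} s j = Gen.detZ S Nc es {f} s (j - t) := by
  unfold Gen.detZ
  simp only [Gen.flipZ_singleton, Gen.run1_translate, Gen.dataX_translate_singleton, HZ_mulVec_translate]
  rfl

/-- `X`-detectors of a translated fault (any event list). -/
theorem Gen.detX_translate_singleton (S : SMCode ℓ m) (Nc : ℕ) (es : List Ev) (f : Fault ℓ m) (t : BB.Mono ℓ m) (s : ℕ)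
    (i : BB.Mono ℓ m) : Gen.detX S Nc es {f.translate t} s i = Gen.detX S Nc es {f} s (i - t) := by
  unfold Gen.detX
  simp only [Gen.flipX_singleton, Gen.run1_translate, Gen.dataZ_translate_singleton, HX_mulVec_translate]
  rfl

end Summit.Ventures.QEC.CircuitDistance
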